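import Summits.KontsevichZagierPeriods.KontsevichZagierPeriods.Theses.PhiFourHepp
import Literature.NumberTheory.Transcendental.KZCalculusProofs

/-!
# PhiFourHepp — no sector decomposition of the kernel crux `PhiFourKernelH`

Strategist r1 census supplement (crux `PhiFourKernelH`, stmt-KontsevichZagierPeriods-12286; tree copy of
the crux workfile `Cruxes/PhiFourKernelH/CensusR1NoSectorSplit.lean`, namespace without `CensusR1`).

A natural attempt to DECOMPOSE a kernel statement
`K(S') : ∀ c, KZ.eval c = 0 → c ∈ closure (moves ∪ S')`
is along a SECTOR `G ≤ FormalRep` (e.g. the subgroup generated by the φ⁴ parametric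
representations, where the Hepp relators `S_H` act): `K(S') ⇐ K_G ∧ K_offG` with
`K_G` the restriction to `c ∈ G` and `K_offG` the restriction to `c ∉ G`.

`kernelFormEnlarged_offSector_iff` certifies that this split is never honest: as soon as ONE
relation of the plain calculus lies outside `G` (for a proper sector this is automatic — split any
off-sector domain in two), the off-sector piece `K_offG` is already equivalent to the whole kernel
statement, by translating an in-sector kernel element by that relator. Hence the in-sector piece
`K_G` is a RUNG of the crux (a strictly-below special case where the route's lever acts), not a
piece of a decomposition, and the complementary piece is the crux again (clause (c) of the
redirect certificate fails). Specialised to the Hepp scheme this is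
`phiFourKernelH_offSector_iff`.
-/

namespace Summit.KontsevichZagierPeriods.PhiFourHepp

open Literature.NumberTheory.Transcendental

/-- **Off-sector piece = whole kernel statement.** For any enlargement `S'` and any subgroup
`G` of formal combinations missing at least one relation of the plain calculus, the kernel
statement restricted to combinations OUTSIDE `G` is equivalent to the unrestricted one. -/
theorem kernelFormEnlarged_offSector_iff (S' : Set KZ.FormalRep) (G : AddSubgroup KZ.FormalRep)
    (hρ : ∃ ρ ∈ KZ.relations, ρ ∉ G) :
    (∀ c : KZ.FormalRep, c ∉ G → KZ.eval c = 0 →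
        c ∈ AddSubgroup.closure (KZ.domainAddRel ∪ KZ.integrandAddRel ∪
          KZ.changeOfVariablesRel ∪ KZ.newtonLeibnizRel ∪ S')) ↔
    (∀ c : KZ.FormalRep, KZ.eval c = 0 →
        c ∈ AddSubgroup.closure (KZ.domainAddRel ∪ KZ.integrandAddRel ∪
          KZ.changeOfVariablesRel ∪ KZ.newtonLeibnizRel ∪ S')) := by
  constructor
  · intro h c hc
    by_cases hcG : c ∈ G
    · obtain ⟨ρ, hρrel, hρG⟩ := hρ
      have hρ0 : KZ.eval ρ = 0 := KZ.relations_le_ker_eval_holds hρrel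
      have hcρG : c + ρ ∉ G := by
        intro hmem
        exact hρG (by simpa using G.sub_mem hmem hcG)
      have hcρ0 : KZ.eval (c + ρ) = 0 := by rw [map_add, hc, hρ0, add_zero]
      have h1 := h (c + ρ) hcρG hcρ0
      have h2 : ρ ∈ AddSubgroup.closure (KZ.domainAddRel ∪ KZ.integrandAddRel ∪
          KZ.changeOfVariablesRel ∪ KZ.newtonLeibnizRel ∪ S') :=
        AddSubgroup.closure_mono Set.subset_union_left hρrel
      simpa using AddSubgroup.sub_mem _ h1 h2
    · exact h c hcG hc
  · intro h c _ hc
    exact h c hc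

/-- **Hepp instance.** The off-sector restriction of `PhiFourKernelH` (to combinations outside
any subgroup `G` missing one plain relation — e.g. the span of the φ⁴ parametric
representations) is equivalent to `PhiFourKernelH` itself: the crux admits no sector split.
[cite: Panzer2022, Conj. 1.2] [cite: KontsevichZagier2001, §1.2 Conjecture 1] -/
theorem phiFourKernelH_offSector_iff (G : AddSubgroup KZ.FormalRep)
    (hρ : ∃ ρ ∈ KZ.relations, ρ ∉ G) :
    (∀ c : KZ.FormalRep, c ∉ G → KZ.eval c = 0 →
        c ∈ AddSubgroup.closure (Literature.NumberTheory.Transcendental.KZ.domainAddRel ∪ Literature.NumberTheory.Transcendental.KZ.integrandAddRel ∪ Literature.NumberTheory.Transcendental.KZ.changeOfVariablesRel ∪ Literature.NumberTheory.Transcendental.KZ.newtonLeibnizRel ∪ {d : Literature.NumberTheory.Transcendental.KZ.FormalRep | ∃ (k₁ k₂ : ℕ) (E₁ : Fin (2*k₁+2) → Fin (k₁+2) × Fin (k₁+2)) (E₂ : Fin (2*k₂+2) → Fin (k₂+2) × Fin (k₂+2)) (r₁ : Literature.NumberTheory.Transcendental.KZ.IntegralRep (2*k₁+1)) (r₂ :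 Literature.NumberTheory.Transcendental.KZ.IntegralRep (2*k₂+1)), (∀ v, (Finset.univ.filter fun e => (E₁ e).1 = v ∨ (E₁ e).2 = v).card ≤ 4) ∧ (∀ v, (Finset.univ.filter fun e => (E₂ e).1 = v ∨ (E₂ e).2 = v).card ≤ 4) ∧ r₁.domain = {x | ∀ j, 0 < x j} ∧ Set.EqOn r₁.integrand (fun x => 1 / ((Matrix.fromBlocks (Matrix.diagonal (Fin.snoc x (1:ℝ) : Fin (2*k₁+2) → ℝ)) (Matrix.of fun (e : Fin (2*k₁+2)) (j : Fin (k₁+1)) => ((if (E₁ e).1 = j.succ then (1:ℝ) else 0) - (if (E₁ e).2 = j.succ then (1:ℝ) else 0))) (-(Matrix.of fun (e : Fin (2*k₁+2)) (j : Fin (k₁+1)) => ((if (E₁ e).1 = j.succ then (1:ℝ) else 0) - (if (E₁ e).2 = j.succ then (1:ℝ) else 0))).transpose) (0 : Matrix (Fin (k₁+1)) (Fin (k₁+1)) ℝ)).det) ^ 2) r₁.domain ∧ r₂.domain = {x | ∀ j, 0 < x j} ∧ Set.EqOn r₂.integrand (fun x => 1 / ((Matrix.fromBlocks (Matrix.diagonal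 (Fin.snoc x (1:ℝ) : Fin (2*k₂+2) → ℝ)) (Matrix.of fun (e : Fin (2*k₂+2)) (j : Fin (k₂+1)) => ((if (E₂ e).1 = j.succ then (1:ℝ) else 0) - (if (E₂ e).2 = j.succ then (1:ℝ) else 0))) (-(Matrix.of fun (e : Fin (2*k₂+2)) (j : Fin (k₂+1)) => ((if (E₂ e).1 = j.succ then (1:ℝ) else 0) - (if (E₂ e).2 = j.succ then (1:ℝ) else 0))).transpose) (0 : Matrix (Fin (k₂+1)) (Fin (k₂+1)) ℝ)).det) ^ 2) r₂.domain ∧ (∑ c : Fin (k₁+1) → Finset (Fin (2*k₁+2)), if ((∀ i : Fin (k₁+1), (c i).Nonempty ∧ (∀ e ∈ c i, (Matrix.of fun (p : {p // p ∈ (c i).erase e}) (v : Fin (k₁+2)) => ((if (E₁ p.1).1 = v then (1:ℚ) else 0) - (if (E₁ p.1).2 = v then (1:ℚ) else 0))).rank = (Matrix.of fun (p : {p // p ∈ c i}) (v : Fin (k₁+2)) => ((if (E₁ p.1).1 = v then (1:ℚ) else 0) - (if (E₁ p.1).2 = v then (1:ℚ) else 0))).rank) ∧ (c i).card - (Matrix.of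 fun (p : {p // p ∈ c i}) (v : Fin (k₁+2)) => ((if (E₁ p.1).1 = v then (1:ℚ) else 0) - (if (E₁ p.1).2 = v then (1:ℚ) else 0))).rank = i.val + 1) ∧ (∀ i j : Fin (k₁+1), i < j → c i ⊂ c j) ∧ c (Fin.last k₁) = Finset.univ) then ((c 0).card : ℚ) * (∏ i : Fin k₁, (((c i.succ).card : ℚ) - ((c i.castSucc).card : ℚ))) / (∏ i : Fin k₁, (((c i.castSucc).card : ℚ) - 2 * ((i.val : ℚ) + 1))) else 0) = (∑ c : Fin (k₂+1) → Finset (Fin (2*k₂+2)), if ((∀ i : Fin (k₂+1), (c i).Nonempty ∧ (∀ e ∈ c i, (Matrix.of fun (p : {p // p ∈ (c i).erase e}) (v : Fin (k₂+2)) => ((if (E₂ p.1).1 = v then (1:ℚ) else 0) - (if (E₂ p.1).2 = v then (1:ℚ) else 0))).rank = (Matrix.of fun (p : {p // p ∈ c i}) (v : Fin (k₂+2)) => ((if (E₂ p.1).1 = v then (1:ℚ) else 0) - (if (E₂ p.1).2 = v then (1:ℚ) else 0))).rank) ∧ (c i).card - (Matrix.of fun (p : {p // p ∈ c i}) (v :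 Fin (k₂+2)) => ((if (E₂ p.1).1 = v then (1:ℚ) else 0) - (if (E₂ p.1).2 = v then (1:ℚ) else 0))).rank = i.val + 1) ∧ (∀ i j : Fin (k₂+1), i < j → c i ⊂ c j) ∧ c (Fin.last k₂) = Finset.univ) then ((c 0).card : ℚ) * (∏ i : Fin k₂, (((c i.succ).card : ℚ) - ((c i.castSucc).card : ℚ))) / (∏ i : Fin k₂, (((c i.castSucc).card : ℚ) - 2 * ((i.val : ℚ) + 1))) else 0) ∧ d = Literature.NumberTheory.Transcendental.KZ.of r₁ - Literature.NumberTheory.Transcendental.KZ.of r₂})) ↔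
    Summit.KontsevichZagierPeriods.KontsevichZagierPeriods.Theses.PhiFourHepp.PhiFourKernelH :=
  kernelFormEnlarged_offSector_iff _ G hρ

/-- **The in-sector piece is a rung, not a co-piece**: `PhiFourKernelH` implies its restriction to
any sector `G` (trivially), so `K_G` is a special case strictly below the crux whenever it is not
the whole crux; combined with `phiFourKernelH_offSector_iff` the attempted split
`K_G ∧ K_offG → K` has `K_offG ↔ K`. -/
theorem phiFourKernelH_sector_of (G : AddSubgroup KZ.FormalRep)
    (hK : Summit.KontsevichZagierPeriods.KontsevichZagierPeriods.Theses.PhiFourHepp.PhiFourKernelH) :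
    ∀ c : KZ.FormalRep, c ∈ G → KZ.eval c = 0 →
        c ∈ AddSubgroup.closure (Literature.NumberTheory.Transcendental.KZ.domainAddRel ∪ Literature.NumberTheory.Transcendental.KZ.integrandAddRel ∪ Literature.NumberTheory.Transcendental.KZ.changeOfVariablesRel ∪ Literature.NumberTheory.Transcendental.KZ.newtonLeibnizRel ∪ {d : Literature.NumberTheory.Transcendental.KZ.FormalRep | ∃ (k₁ k₂ : ℕ) (E₁ : Fin (2*k₁+2) → Fin (k₁+2) × Fin (k₁+2)) (E₂ : Fin (2*k₂+2) → Fin (k₂+2) × Fin (k₂+2)) (r₁ : Literature.NumberTheory.Transcendental.KZ.IntegralRep (2*k₁+1)) (r₂ : Literature.NumberTheory.Transcendental.KZ.IntegralRep (2*k₂+1)), (∀ v, (Finset.univ.filter fun e => (E₁ e).1 = v ∨ (E₁ e).2 = v).card ≤ 4) ∧ (∀ v, (Finset.univ.filter fun e => (E₂ e).1 = v ∨ (E₂ e).2 = v).card ≤ 4) ∧ r₁.domain = {x | ∀ j, 0 < x j} ∧ Set.EqOn r₁.integrand (fun x => 1 / ((Matrix.fromBlocks (Matrix.diagonal (Fin.snoc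 x (1:ℝ) : Fin (2*k₁+2) → ℝ)) (Matrix.of fun (e : Fin (2*k₁+2)) (j : Fin (k₁+1)) => ((if (E₁ e).1 = j.succ then (1:ℝ) else 0) - (if (E₁ e).2 = j.succ then (1:ℝ) else 0))) (-(Matrix.of fun (e : Fin (2*k₁+2)) (j : Fin (k₁+1)) => ((if (E₁ e).1 = j.succ then (1:ℝ) else 0) - (if (E₁ e).2 = j.succ then (1:ℝ) else 0))).transpose) (0 : Matrix (Fin (k₁+1)) (Fin (k₁+1)) ℝ)).det) ^ 2) r₁.domain ∧ r₂.domain = {x | ∀ j, 0 < x j} ∧ Set.EqOn r₂.integrand (fun x => 1 / ((Matrix.fromBlocks (Matrix.diagonal (Fin.snoc x (1:ℝ) : Fin (2*k₂+2) → ℝ)) (Matrix.of fun (e : Fin (2*k₂+2)) (j : Fin (k₂+1)) => ((if (E₂ e).1 = j.succ then (1:ℝ) else 0) - (if (E₂ e).2 = j.succ then (1:ℝ) else 0))) (-(Matrix.of fun (e : Fin (2*k₂+2)) (j : Fin (k₂+1)) => ((if (E₂ e).1 = j.succ then (1:ℝ) else 0) - (if (E₂ e).2 = j.succ then (1:ℝ)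 else 0))).transpose) (0 : Matrix (Fin (k₂+1)) (Fin (k₂+1)) ℝ)).det) ^ 2) r₂.domain ∧ (∑ c : Fin (k₁+1) → Finset (Fin (2*k₁+2)), if ((∀ i : Fin (k₁+1), (c i).Nonempty ∧ (∀ e ∈ c i, (Matrix.of fun (p : {p // p ∈ (c i).erase e}) (v : Fin (k₁+2)) => ((if (E₁ p.1).1 = v then (1:ℚ) else 0) - (if (E₁ p.1).2 = v then (1:ℚ) else 0))).rank = (Matrix.of fun (p : {p // p ∈ c i}) (v : Fin (k₁+2)) => ((if (E₁ p.1).1 = v then (1:ℚ) else 0) - (if (E₁ p.1).2 = v then (1:ℚ) else 0))).rank) ∧ (c i).card - (Matrix.of fun (p : {p // p ∈ c i}) (v : Fin (k₁+2)) => ((if (E₁ p.1).1 = v then (1:ℚ) else 0) - (if (E₁ p.1).2 = v then (1:ℚ) else 0))).rank = i.val + 1) ∧ (∀ i j : Fin (k₁+1), i < j → c i ⊂ c j) ∧ c (Fin.last k₁) = Finset.univ) then ((c 0).card : ℚ) * (∏ i : Fin k₁, (((c i.succ).card : ℚ) - ((c i.castSucc).card : ℚ))) / (∏ i : Fin k₁,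 (((c i.castSucc).card : ℚ) - 2 * ((i.val : ℚ) + 1))) else 0) = (∑ c : Fin (k₂+1) → Finset (Fin (2*k₂+2)), if ((∀ i : Fin (k₂+1), (c i).Nonempty ∧ (∀ e ∈ c i, (Matrix.of fun (p : {p // p ∈ (c i).erase e}) (v : Fin (k₂+2)) => ((if (E₂ p.1).1 = v then (1:ℚ) else 0) - (if (E₂ p.1).2 = v then (1:ℚ) else 0))).rank = (Matrix.of fun (p : {p // p ∈ c i}) (v : Fin (k₂+2)) => ((if (E₂ p.1).1 = v then (1:ℚ) else 0) - (if (E₂ p.1).2 = v then (1:ℚ) else 0))).rank) ∧ (c i).card - (Matrix.of fun (p : {p // p ∈ c i}) (v : Fin (k₂+2)) => ((if (E₂ p.1).1 = v then (1:ℚ) else 0) - (if (E₂ p.1).2 = v then (1:ℚ) else 0))).rank = i.val + 1) ∧ (∀ i j : Fin (k₂+1), i < j → c i ⊂ c j) ∧ c (Fin.last k₂) = Finset.univ) then ((c 0).card : ℚ) * (∏ i : Fin k₂, (((c i.succ).card : ℚ) - ((c i.castSucc).card : ℚ))) / (∏ i : Fin k₂, (((c i.castSucc).card : ℚ) - 2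 * ((i.val : ℚ) + 1))) else 0) ∧ d = Literature.NumberTheory.Transcendental.KZ.of r₁ - Literature.NumberTheory.Transcendental.KZ.of r₂}) :=
  fun c _ hc => hK c hc

/-- **A relation outside every proper "shape" sector exists**: concretely, the plain calculus has a
non-zero relation (so the hypothesis `hρ` of `kernelFormEnlarged_offSector_iff` holds for every
subgroup `G` not containing all of `KZ.relations`). Stated in the form used: if `KZ.relations ≤ G`
fails then `hρ` holds. -/
theorem exists_relation_not_mem (G : AddSubgroup KZ.FormalRep)
    (hG : ¬ ((KZ.relations : AddSubgroup KZ.FormalRep) ≤ G)) : ∃ ρ ∈ KZ.relations, ρ ∉ G := by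
  by_contra h
  exact hG fun ρ hρ => by_contra fun hρG => h ⟨ρ, hρ, hρG⟩

end Summit.KontsevichZagierPeriods.PhiFourHepp
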